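import Mathlib
import Summits.NavierStokesRegularity.NavierStokesRegularity.Theorems.EulerZoomLiouvillePowerGaugeEulerLiouvilleAnchoredBudgetLocalFloor
import Summits.NavierStokesRegularity.NavierStokesRegularity.Theorems.EulerZoomLiouvillePowerGaugeEulerLiouvilleSwirlfreeLedgerFlow
import HarnessLib

/-!
# Crux `EulerZoomLiouville.PowerGaugeEulerLiouville` (stmt-NavierStokesRegularity-19832), line `stretching-budget` rev4, stub K1′:
# FLOOR BLOBS PERSIST BACKWARD — GRADIENT-FREE (the cutoff-field flow replaces the global particle flow)

Route №10 `EulerZoomLiouville` (NavierStokesRegularity), crux E.  Line `stretching-budget` (ideator ns-idea-11 g4;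
`Cruxes/PowerGaugeEulerLiouville/Lines/stretching_budget.lean` rev4 8cfa8ef277cf), stub **K1 `stub_floorTransport` in its GRADIENT-FREE text**
(`IsDriftingPastWith` := classical on `(−∞,0)` ∧ `T₁ ≤ 0` ∧ `0 ≤ M` ∧ `κ < 1` ∧ velocity envelope `‖u(τ,x)‖ ≤ M(−τ)^{−κ}` on `(−∞,T₁)` —
NO clause on the gradient).  The rev1 text WITH the clause «`∇u` bounded on compact time sets, uniformly in `x`» is LANDED
(`StretchingBudget.floorBlobsPersist_of_driftingPast`, ns-in-ser-c g2, p630159); the clause only served to make the particle flow of `u` global.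
Here it is removed, exactly as the card (rev2/rev4) prescribes: the Literature flow kit is run on the CUTOFF FIELD `ψ·u` (`ψ` a smooth bump
`= 1` on `B̄(0, ‖x₀‖ + δ + D + 1)`, `D` = drift radius), using the tree kit of the sibling line `anchored-budget`
(`AnchoredBudget.isUniformlyLipschitzOn_cutoff`, `hasDerivAt_cutoffFlow_of_mem`, `volume_image_cutoffFlow_eq`, `measurableSet_image_cutoffFlow`,
p631088; `AnchoredBudget.sq_norm_curl_floor_along_curve`, p630763):

* CONFINEMENT: `‖ψu‖ ≤ ‖u‖ ≤ M(−s)^{−κ}` everywhere, so `SwirlfreeLedger.norm_evolutionMap_sub_le` (p609033) bounds the displacement of EVERY label by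
  the drift radius `D = M((−t₁)^{1−κ} − (−t₀)^{1−κ})/(1−κ)`; the labels of the blob `B(x₀,δ)` therefore STAY in `B(0, ‖x₀‖+δ+D)`, inside the
  plateau where `ψ = 1`: their trajectories are `u`-trajectories and the Jacobian along them is one (Liouville's formula, `div(ψu) = div u = 0` there);
* AVATAR `T = X_{t₁}(B(x₀,δ))`: measurable, `⊆ B(0, ‖x₀‖+δ+D)`, SAME volume;
* FLOOR: backward Grönwall along each `u`-trajectory under the stretching budget (`sq_norm_curl_floor_along_curve`; the gradient bound along
  the curve comes from compactness — no spatial clause).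

* `floorBlobsPersist_of_driftingPast_free` — **K1′ = `Sig.stub_floorTransport` (rev4, gradient-free) with `IsDriftingPastWith`, `HasStretchingBudget`,
  `FloorBlobsPersist`, `driftRadius` UNFOLDED VERBATIM.**

WHAT THIS IS NOT: not NS regularity, not the crux E — ONE line stub `--supports` stmt-19832; pure kinematics of a classical flow.
[cite: MajdaBertozziCUP2002, §1.3 Prop. 1.4, §1.6 (1.51), §2.5 (2.115)–(2.117); Chae2010, Thm 1.1 (proof display)]
-/

noncomputable section

-- flat `Theorems/<Route><Decl>…` files of one crux share the namespace of the crux (tree convention)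
set_option linter.dupNamespace false

open MeasureTheory Set Filter Topology Metric Function InnerProductSpace
open scoped NNReal ENNReal RealInnerProductSpace

namespace Summit.NavierStokesRegularity.NavierStokesRegularity.Theorems.PowerGaugeEulerLiouville.StretchingBudget

open Literature.Analysis Literature.Analysis.FluidPDE Literature.Analysis.ODE
open Summit.NavierStokesRegularity.NavierStokesRegularity.Theorems.PowerGaugeEulerLiouville.SwirlfreeLedger (norm_evolutionMap_sub_le)
open Summit.NavierStokesRegularity.NavierStokesRegularity.Theorems.PowerGaugeEulerLiouville.AnchoredBudget
  (isUniformlyLipschitzOn_cutoff hasDerivAt_cutoffFlow_of_mem volume_image_cutoffFlow_eq measurableSet_image_cutoffFlow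
    sq_norm_curl_floor_along_curve)

/-- **K1′ · FLOOR BLOBS PERSIST BACKWARD on a drifting classical far past with a stretching budget — GRADIENT-FREE** (the rev4 text of
`Sig.stub_floorTransport`, defs unfolded): classical Euler on `(−∞,0)`, `T₁ ≤ 0`, `0 ≤ M`, `κ < 1`, envelope `‖u(τ,x)‖ ≤ M(−τ)^{−κ}` for `τ < T₁`,
budget `⟪∇u ω, ω⟫ ≤ (K/(−τ) + Λ(τ))|ω|²` with `Λ ≥ 0` integrable on `(−∞,T₁)`, `K ≥ 0`.  Then every blob `B(x₀,δ)` at `t₀ < T₁` with `|ω(t₀)| ≥ w ≥ 0`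
has at every `t₁ < t₀` a measurable avatar `T ⊆ B(0, ‖x₀‖ + δ + D)`, `D = M((−t₁)^{1−κ} − (−t₀)^{1−κ})/(1−κ)`, of the SAME volume, on which
`|ω(t₁)|² ≥ w² e^{−2∫_{(t₁,t₀)}Λ} ((−t₀)/(−t₁))^{2K}` (`T` = image of the blob under the cutoff-field flow, which is the particle flow there).
[cite: MajdaBertozziCUP2002, §1.3 Prop. 1.4, §1.6 (1.51), §2.5 (2.115)–(2.117)] -/
theorem floorBlobsPersist_of_driftingPast_free :
    ∀ (u : ℝ → EuclideanSpace ℝ (Fin 3) → EuclideanSpace ℝ (Fin 3)) (p : ℝ → EuclideanSpace ℝ (Fin 3) → ℝ) (T₁ M κ K : ℝ)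
      (Λ : ℝ → ℝ),
      (IsClassicalEulerSolutionOn (Set.Iio 0) 0 u p ∧ T₁ ≤ 0 ∧ 0 ≤ M ∧ κ < 1 ∧
          (∀ τ : ℝ, τ < T₁ → ∀ x : EuclideanSpace ℝ (Fin 3), ‖u τ x‖ ≤ M * (-τ) ^ (-κ))) →
        0 ≤ K →
          (IntegrableOn Λ (Set.Iio T₁) ∧ (∀ τ : ℝ, 0 ≤ Λ τ) ∧
              ∀ τ : ℝ, τ < T₁ → ∀ x : EuclideanSpace ℝ (Fin 3),
                ⟪fderiv ℝ (u τ) x (curl (u τ) x), curl (u τ) x⟫ ≤ (K / (-τ) + Λ τ) * ‖curl (u τ) x‖ ^ 2) →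
            ∀ t₀ : ℝ, t₀ < T₁ → ∀ (x₀ : EuclideanSpace ℝ (Fin 3)) (δ w : ℝ), 0 < δ → 0 ≤ w →
              (∀ x ∈ ball x₀ δ, w ≤ ‖curl (u t₀) x‖) →
                ∀ t₁ : ℝ, t₁ < t₀ →
                  ∃ T : Set (EuclideanSpace ℝ (Fin 3)), MeasurableSet T ∧
                    T ⊆ ball (0 : EuclideanSpace ℝ (Fin 3))
                      (‖x₀‖ + δ + M / (1 - κ) * ((-t₁) ^ (1 - κ) - (-t₀) ^ (1 - κ))) ∧
                    volume T = volume (ball x₀ δ) ∧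
                    ∀ x ∈ T,
                      w ^ 2 * Real.exp (-(2 * ∫ s in Set.Ioo t₁ t₀, Λ s)) * ((-t₀) / (-t₁)) ^ (2 * K) ≤
                        ‖curl (u t₁) x‖ ^ 2 := by
  intro u p T₁ M κ K Λ hD _hK0 hB t₀ ht₀T x₀ δ w hδ hw hball t₁ ht₁
  obtain ⟨hcl, hT₁, hM0, hκ1, henv⟩ := hD
  obtain ⟨hΛi, _hΛ0, hstretch⟩ := hB
  have ht₀ : t₀ < 0 := lt_of_lt_of_le ht₀T hT₁
  have ht₁0 : t₁ < 0 := ht₁.trans ht₀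
  -- the drift radius `D ≥ 0`
  set D : ℝ := M / (1 - κ) * ((-t₁) ^ (1 - κ) - (-t₀) ^ (1 - κ)) with hDdef
  have h1κ : 0 < 1 - κ := by linarith
  have hMκ : 0 ≤ M / (1 - κ) := div_nonneg hM0 h1κ.le
  have hmono : ∀ s ∈ Icc t₁ t₀, M / (1 - κ) * ((-s) ^ (1 - κ) - (-t₀) ^ (1 - κ)) ≤ D := by
    intro s hs
    rw [hDdef]
    refine mul_le_mul_of_nonneg_left ?_ hMκ
    have h : (-s) ^ (1 - κ) ≤ (-t₁) ^ (1 - κ) :=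
      Real.rpow_le_rpow (by linarith [hs.2]) (by linarith [hs.1]) h1κ.le
    linarith
  have hD0 : 0 ≤ D := by simpa using hmono t₀ (right_mem_Icc.2 ht₁.le)
  -- the time set `(−∞,0)` and the cutoff flow of `ψ·u`, `ψ = 1` on `B̄(0, ‖x₀‖ + δ + D + 1)`
  have hSc : Convex ℝ (Iio (0 : ℝ)) := convex_Iio 0
  have hU : UniqueDiffOn ℝ (Iio (0 : ℝ)) := uniqueDiffOn_Iio 0
  have ht₀S : t₀ ∈ Iio (0 : ℝ) := ht₀
  have ht₁S : t₁ ∈ Iio (0 : ℝ) := ht₁0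
  have hIcc : Icc t₁ t₀ ⊆ Iio (0 : ℝ) := fun s hs => lt_of_le_of_lt hs.2 ht₀
  have hsm : IsSmoothSpaceTimeOn (Iio 0) u := hcl.smooth_velocity
  obtain ⟨φ, hφa⟩ : ∃ φ : ContDiffBump (0 : EuclideanSpace ℝ (Fin 3)), φ.rIn = ‖x₀‖ + δ + D + 1 :=
    ⟨⟨‖x₀‖ + δ + D + 1, ‖x₀‖ + δ + D + 2, by linarith [norm_nonneg x₀], by linarith⟩, rfl⟩
  set X : ℝ → EuclideanSpace ℝ (Fin 3) → EuclideanSpace ℝ (Fin 3) :=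
    ODE.evolutionMap (fun t x => (φ : EuclideanSpace ℝ (Fin 3) → ℝ) x • u t x) t₀ with hX
  have hL := isUniformlyLipschitzOn_cutoff hsm hU φ
  have hX0 : ∀ y, X t₀ y = y := fun y => by rw [hX, ODE.evolutionMap_self]
  -- speed of the cutoff field: `‖ψ u‖ ≤ ‖u‖ ≤ M(−s)^{−κ}`
  have hspeed : ∀ s ∈ Icc t₁ t₀, ∀ y : EuclideanSpace ℝ (Fin 3),
      ‖(φ : EuclideanSpace ℝ (Fin 3) → ℝ) y • u s y‖ ≤ M * (-s) ^ (-κ) := by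
    intro s hs y
    rw [norm_smul, Real.norm_of_nonneg φ.nonneg]
    calc φ y * ‖u s y‖ ≤ 1 * ‖u s y‖ := mul_le_mul_of_nonneg_right φ.le_one (norm_nonneg _)
      _ = ‖u s y‖ := one_mul _
      _ ≤ M * (-s) ^ (-κ) := henv s (lt_of_le_of_lt hs.2 ht₀T) y
  -- CONFINEMENT: every label of the blob stays in `B(0, ‖x₀‖ + δ + D)` on `[t₁,t₀]`
  have hconf : ∀ a ∈ ball x₀ δ, ∀ s ∈ Icc t₁ t₀, ‖X s a‖ < ‖x₀‖ + δ + D := by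
    intro a ha s hs
    have hd : ‖X s a - a‖ ≤ M / (1 - κ) * ((-s) ^ (1 - κ) - (-t₀) ^ (1 - κ)) :=
      norm_evolutionMap_sub_le hL hSc isOpen_Iio ht₁S ht₀S ht₀ hκ1 hspeed a hs
    have han : ‖a‖ < ‖x₀‖ + δ := by
      have h1 : ‖a - x₀‖ < δ := mem_ball_iff_norm.1 ha
      linarith [norm_le_norm_add_norm_sub' a x₀]
    calc ‖X s a‖ ≤ ‖a‖ + ‖X s a - a‖ := norm_le_norm_add_norm_sub' _ _
      _ < ‖x₀‖ + δ + D := add_lt_add_of_lt_of_le han (hd.trans (hmono s hs))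
  have hstay : ∀ a ∈ ball x₀ δ, ∀ σ ∈ uIcc t₀ t₁, X σ a ∈ ball (0 : EuclideanSpace ℝ (Fin 3)) φ.rIn := by
    intro a ha σ hσ
    rw [uIcc_of_ge ht₁.le] at hσ
    rw [hφa, mem_ball_zero_iff]
    linarith [hconf a ha σ hσ]
  have hstay' : ∀ a ∈ ball x₀ δ, ∀ s ∈ Icc t₁ t₀, X s a ∈ closedBall (0 : EuclideanSpace ℝ (Fin 3)) φ.rIn :=
    fun a ha s hs => ball_subset_closedBall (hstay a ha s (by rw [uIcc_of_ge ht₁.le]; exact hs))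
  -- the avatar `T = X_{t₁}(B(x₀, δ))`
  refine ⟨X t₁ '' ball x₀ δ, measurableSet_image_cutoffFlow hsm hSc hU φ ht₀S ht₁S measurableSet_ball, ?_, ?_, ?_⟩
  · rintro _ ⟨a, ha, rfl⟩
    exact mem_ball_zero_iff.2 (hconf a ha t₁ (left_mem_Icc.2 ht₁.le))
  · exact volume_image_cutoffFlow_eq hcl hSc hU φ ht₀S ht₁S measurableSet_ball hstay
  · -- the floor along the `u`-trajectory of `a ∈ B(x₀, δ)` (inside the plateau the cutoff flow IS the particle flow)
    rintro _ ⟨a, ha, rfl⟩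
    have hγ : ∀ s ∈ Icc t₁ t₀, HasDerivAt (fun s => X s a) (u s (X s a)) s := fun s hs =>
      hasDerivAt_cutoffFlow_of_mem hsm hSc hU φ ht₀S (isOpen_Iio.mem_nhds (hIcc hs)) (hstay' a ha s hs)
    have hfl := sq_norm_curl_floor_along_curve hcl ht₁ ht₀ hγ (K := K)
      (hΛi.mono_set fun s hs => lt_of_le_of_lt hs.2 ht₀T) (fun τ hτ x => hstretch τ (lt_of_le_of_lt hτ.2 ht₀T) x)
    rw [hX0 a] at hfl
    refine le_trans ?_ hfl
    have hwa : w ^ 2 ≤ ‖curl (u t₀) a‖ ^ 2 := pow_le_pow_left₀ hw (hball a ha) 2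
    have hnn : 0 ≤ Real.exp (-(2 * ∫ s in Ioo t₁ t₀, Λ s)) * ((-t₀) / (-t₁)) ^ (2 * K) :=
      mul_nonneg (Real.exp_pos _).le (Real.rpow_nonneg (div_nonneg (by linarith) (by linarith)) _)
    calc w ^ 2 * Real.exp (-(2 * ∫ s in Ioo t₁ t₀, Λ s)) * ((-t₀) / (-t₁)) ^ (2 * K)
        = w ^ 2 * (Real.exp (-(2 * ∫ s in Ioo t₁ t₀, Λ s)) * ((-t₀) / (-t₁)) ^ (2 * K)) := by ring
      _ ≤ ‖curl (u t₀) a‖ ^ 2 * (Real.exp (-(2 * ∫ s in Ioo t₁ t₀, Λ s)) * ((-t₀) / (-t₁)) ^ (2 * K)) :=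
          mul_le_mul_of_nonneg_right hwa hnn
      _ = ‖curl (u t₀) a‖ ^ 2 * Real.exp (-(2 * ∫ s in Ioo t₁ t₀, Λ s)) * ((-t₀) / (-t₁)) ^ (2 * K) := by ring

end Summit.NavierStokesRegularity.NavierStokesRegularity.Theorems.PowerGaugeEulerLiouville.StretchingBudget

end
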